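import Literature.MathematicalPhysics.QuantumFieldTheory.Balaban1983to89.B8Eq166ConstraintPair

/-!
# `Balaban1983to89.B8Thm4HypothesesPair` — T. Bałaban, *Spaces of regular gauge field configurations on a lattice and
# gauge fixing conditions*, Commun. Math. Phys. **99** (1985) 75–102 [Balaban1985RegularSpaces] ("B8"), **Theorem 4** (p. 88)
# APPLIES AT A PAIR WITH EQUAL `k`-TH AVERAGES: its hypotheses (1.34) (`Ax_k(ℭ_k, U₀)`) and (1.66) in the EXACT binder shapes
# of the tree's typed interface `B8Eq119TwistedAxial.Thm4At` (admissible cube family `{□_j}` of (1.131), `B8Prop6OfThm4.Cond166`)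
# are DISCHARGED by the pinned axial gauge of `B8Eq166ConstraintPair`, and (1.34)'s `𝔄_k`-clause for the gauged field is
# (1.34)'s clause for the field itself (gauge invariance of `𝔄_k`, p. 77, `B8Ineq132.inAk_gaugeAct_iff`); so `Thm4At` yields its
# conclusion at the pair from `𝔄_k`-membership of the two fields and «(3.35) of [4]» for the background ALONE

statement-level skeleton of published theorems with citation tags; proofs where landed; nothing here is a claim about the Yang–Mills mass gap

WHY (pub-ymgap Track A, DAG node N16 = NE3, seat `pub-ymgap-dag-n16-b`): the in-edge N05 → N16 of the DAG ([B8] Theorem 2 ∕ Theorem 4 at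
the minimiser pair `(U₀, U) = (W, U_A)` of [Balaban1985Variational] (13), both with `k`-th average `V`) is to be consumed BY NAME through
the tree's typed Theorem-4 interface for a general background, `B8Eq119TwistedAxial.Thm4At` (p. 88; `Reg`, `Restr`, `Concl` abstract —
the N05 side instantiates them).  `B8Eq166ConstraintPair` (this seat) built the pinned axial gauge `u₀ = ptw L U₀ U k` with (1.19) at every
block of every level and (1.66) with `α₁ = 0` on every bond; this file reads those facts in `Thm4At`'s own binders and performs the modus
ponens, so that at the pair Theorem 4's conclusion needs ONLY: `U₀, U ∈ 𝔄_k({□_j}, α₀)` (`B8Ineq132.InAk` — (1.7) plaquettes + (1.9)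
currents, the class data of the two minimisers and of the averaged one) and `Reg U₀`.

THE PRINTED TEXT (p. 88, verbatim): «Theorem 4. There exists a constant c₁ such that for arbitrary U₀, U′U₀ satisfying (1.33), (1.34),
(1.66) with α₀ + α₁ ≤ c₁ there exists exactly one gauge transformation u satisfying (1.29) and such that the conditions (1.37), (1.38),
(1.62) hold for the configuration U₁ = U′^{u⁻¹}.»  (1.33)–(1.34) p. 82: «U₀ ∈ 𝔄_k({Ω_j}, α₀), U₀ satisfies the regularity condition
(3.35) in [4]. (1.33)  U′U₀ ∈ 𝔄_k({Ω_j}, α₀) ∩ Ax_k(𝔅_k, U₀), (1.34)»; p. 77: «Thus the space 𝔄_k({Ω_j}, α₀) is invariant with respect to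
gauge transformations»; (1.66) p. 87: «|(\overline{U′U₀})ʲ − Ū₀ʲ| = |Ũ′ʲ − 1| < α₁ on Ω_j^{(j)}, j = 0, 1, …, k».

WHAT IS CERTIFIED HERE (kernel; std axioms; `ℤᵈ` carriers and dictionary of the parent files): with `u₀ := ptw L U₀ U k` (the pinned
axial gauge of `U` relative to `U₀`, `B8Eq166ConstraintPair.ptw`) and the PERTURBATION `U′ := pert (U^{u₀}) U₀` ((1.16) `U′ = U^{u₀}U₀⁻¹`,
so that `U′·U₀ = U^{u₀}`, `pertPair_mul`; written out as `pert (gaugeAct (ptw L U₀ U k) U) U₀`, no definition):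
* `pertPair_mem` — `U′` is `G`-valued; `inAk_pertPair_iff` — `U′·U₀ ∈ 𝔄_k({Ω_j}, α)` iff `U ∈ 𝔄_k({Ω_j}, α)` (gauge invariance p. 77);
* `inAx_pertPair` — (1.34)'s axial clause `U′·U₀ ∈ Ax_k(ℭ, U₀)` for EVERY family `ℭ`, in particular `ℭ_k = LamP` of (1.131);
* `cond166_pertPair` — **(1.66) in `Thm4At`'s binder shape** `Cond166 L k a M ρ U₀ U′ (11d²α)` for EVERY cube datum `(a, M, ρ)`, from
  `B8Eq166ConstraintPair.ineq166_pair` (every bond of every level) — given equal `k`-th averages `Ūᵏ = Ū₀ᵏ`;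
* **`concl_of_thm4At_pair`** — THE MODUS PONENS: `Thm4At L k η c₁ G a M ρ Reg Restr Concl`, `U₀, U` `G`-valued with (1.7)
  `sup_p |·(∂p) − 1| < α·L^{−2k}` (`α` Prop.-1∕2-small, `11d²α ≤ 1∕6`), `Ūᵏ = Ū₀ᵏ`, `U₀, U ∈ 𝔄_k({□_j}, α)`, `Reg U₀`, `α + 11d²α ≤ c₁`
  ⟹ `∃ u`, `G`-valued, `Restr U₀ u ∧ Concl α (11d²α) U₀ U′ u`, unique among such — Theorem 4's conclusion AT THE PAIR in the gauge
  `u₀`, i.e. for `U₁ = U′^{u⁻¹}` with `U′ = U^{u₀}U₀⁻¹`.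
HONEST SCOPE.  (i) `Thm4At` is a HYPOTHESIS SHAPE (Theorem 4 is NOT proved here or in the tree at a curved background); this file only
shows that its pair-specific hypotheses are theorems, leaving `InAk` for both fields ((1.7) + (1.9): class data) and `Reg U₀` ((3.35) of
[4]) displayed.  (ii) `α₁ = 11d²α` is (1.65)'s printed constant with the closeness term `0` (equal top averages).  (iii) `ℤᵈ` carriers,
every level `ℤᵈ`, as in the parents.  No `sorry`; axioms `propext`/`Classical.choice`/`Quot.sound`.
-/

noncomputable section

open scoped BigOperators
open Finset

namespace Literature.MathematicalPhysics.QuantumFieldTheory.Balaban1983to89.B8Thm4HypothesesPair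

open B7Prop1Explicit B7Prop2Explicit B7AvgGaugeCovariance B8Ineq130 B8Eq115GaugeFixing B8Eq119TwistedAxial B8Ineq132 B8Eq131Cubes
  B8Prop6OfThm4 B8Eq166ConstraintPair
open B8Lemma1NonAbelian (mulCfg pert pert_mulCfg)
export B7Prop1Explicit (Site)

variable {d : ℕ}

variable {𝔸 : Type*} [NormedRing 𝔸] [NormOneClass 𝔸] [NormedAlgebra ℂ 𝔸] [CompleteSpace 𝔸]

omit [NormOneClass 𝔸] in
/-- (1.16): `U′·U₀ = U^{u₀}`. [cite: Balaban1985RegularSpaces, (1.16) p.78] -/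
theorem pertPair_mul (L : ℕ) (U₀ U : Site d → Fin d → 𝔸ˣ) (k : ℕ) :
    pert (gaugeAct (ptw L U₀ U k) U) U₀ * U₀ = gaugeAct (ptw L U₀ U k) U := by
  rw [← mulCfg_eq_mul]; exact mulCfg_pert _ _

omit [NormOneClass 𝔸] in
/-- `U′` is `G`-valued when `U₀` and `U^{u₀}` are. [cite: Balaban1985Averaging, (8) p.18] -/
theorem pertPair_mem {G : Subgroup 𝔸ˣ} {L : ℕ} {U₀ U : Site d → Fin d → 𝔸ˣ} {k : ℕ} (hU₀ : ∀ x κ, U₀ x κ ∈ G)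
    (hUu : ∀ x κ, gaugeAct (ptw L U₀ U k) U x κ ∈ G) (x : Site d) (κ : Fin d) : pert (gaugeAct (ptw L U₀ U k) U) U₀ x κ ∈ G :=
  G.mul_mem (hUu x κ) (G.inv_mem (hU₀ x κ))

/-- **(1.34), `𝔄_k`-clause, by gauge invariance** (p. 77 «the space 𝔄_k({Ω_j}, α₀) is invariant with respect to gauge
transformations», `B8Ineq132.inAk_gaugeAct_iff`): for `u₀` with values in `{|u| ≤ 1, |u⁻¹| ≤ 1}`, `U′·U₀ = U^{u₀} ∈ 𝔄_k({Ω_j}, α)` iff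
`U ∈ 𝔄_k({Ω_j}, α)`. [cite: Balaban1985RegularSpaces, (1.34) p.82, p.77] -/
theorem inAk_pertPair_iff (L k : ℕ) (η α : ℝ) (Ω : ℕ → Set (Site d)) {U₀ U : Site d → Fin d → 𝔸ˣ}
    (hu : ∀ x, ptw L U₀ U k x ∈ U1 𝔸) : InAk L k η α Ω (pert (gaugeAct (ptw L U₀ U k) U) U₀ * U₀) ↔ InAk L k η α Ω U := by
  rw [pertPair_mul]; exact inAk_gaugeAct_iff L k η α Ω hu U

/-- **(1.34), axial clause, at the pair**: `U′·U₀ ∈ Ax_k(ℭ, U₀)` for EVERY family `ℭ` of constraint sets (`B8Eq119TwistedAxial.InAx`),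
in particular for `ℭ_k = ⋃ Λ′_j` of (1.131) (`B8Eq131Cubes.LamP`) — `B8Eq166ConstraintPair.inAx_pinnedTwistedFix`.
[cite: Balaban1985RegularSpaces, (1.34) p.82, (1.19) p.79] -/
theorem inAx_pertPair (L : ℕ) (hL : 2 ≤ L) {G : Subgroup 𝔸ˣ} (hG : AvgClosed d L G) (k : ℕ)
    (U₀ U : Site d → Fin d → 𝔸ˣ) (hU₀ : ∀ x κ, U₀ x κ ∈ G) (hU : ∀ x κ, U x κ ∈ G) {α : ℝ} (hα : 0 < α)
    (hα3 : C0 d * α ≤ 1 / 3) (hα2 : 2 * α ≤ c2' d L)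
    (h33 : pdev U₀ < α * (((L : ℝ) ^ k)⁻¹) ^ 2) (h34 : pdev U < α * (((L : ℝ) ^ k)⁻¹) ^ 2) (Λ : ℕ → Set (Site d)) :
    InAx L k Λ U₀ (pert (gaugeAct (ptw L U₀ U k) U) U₀ * U₀) := by
  rw [pertPair_mul]; exact inAx_pinnedTwistedFix L hL hG k U₀ U hU₀ hU hα hα3 hα2 h33 h34 Λ

/-- **(1.66) IN THEOREM 4's BINDER SHAPE AT THE PAIR**: for `U₀`, `U` `G`-valued with (1.7) and EQUAL `k`-th averages, and for EVERY
cube datum `(a, M, ρ)` of the admissible family (1.131): `Cond166 L k a M ρ U₀ U′ (11d²α)` — `|Ũ′ʲ − 1| < 11d²α` on `□_j^{(j)}`,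
`j = 0, …, k` (indeed on every bond of every level, `B8Eq166ConstraintPair.ineq166_pair`; `Ũ′ʲ = tavg L U₀ U′ j = pert (Ū^{u₀,j}) (Ū₀ʲ)`).
[cite: Balaban1985RegularSpaces, (1.66) p.87, (1.20) p.79] -/
theorem cond166_pertPair (L : ℕ) (hL : 2 ≤ L) (hd : 1 ≤ d) {G : Subgroup 𝔸ˣ} (hG : AvgClosed d L G) (k : ℕ)
    (U₀ U : Site d → Fin d → 𝔸ˣ) (hU₀ : ∀ x κ, U₀ x κ ∈ G) (hU : ∀ x κ, U x κ ∈ G) {α : ℝ} (hα : 0 < α)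
    (hα3 : C0 d * α ≤ 1 / 3) (hα2 : 2 * α ≤ c2' d L)
    (h33 : pdev U₀ < α * (((L : ℝ) ^ k)⁻¹) ^ 2) (h34 : pdev U < α * (((L : ℝ) ^ k)⁻¹) ^ 2)
    (hpair : avgIter L U k = avgIter L U₀ k) (hsmall : 11 * (d : ℝ) ^ 2 * α ≤ 1 / 6) (a : Site d) (M ρ : ℕ) :
    Cond166 L k a M ρ U₀ (pert (gaugeAct (ptw L U₀ U k) U) U₀) (11 * (d : ℝ) ^ 2 * α) := by
  intro j hj x ν _ _
  have h := ineq166_pair L hL hd hG k U₀ U hU₀ hU hα hα3 hα2 h33 h34 hpair hsmall (k - j) (Nat.sub_le k j) x ν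
  rw [show k - (k - j) = j by omega] at h
  have e : tavg L U₀ (pert (gaugeAct (ptw L U₀ U k) U) U₀) j = pert (avgIter L (gaugeAct (ptw L U₀ U k) U) j) (avgIter L U₀ j) := by
    rw [← pert_avgIter, pertPair_mul]
  rw [e]; exact h

/-- **THEOREM 4 APPLIES AT THE PAIR** (modus ponens on the tree's typed interface `B8Eq119TwistedAxial.Thm4At`, p. 88): for an
`AvgClosed` gauge group `G`, `L ≥ 2`, `d ≥ 1`, `G`-valued `U₀`, `U` with (1.7) `sup_p |·(∂p) − 1| < α·L^{−2k}` (`α` Prop.-1∕2-small,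
`11d²α ≤ 1∕6`) and EQUAL `k`-th averages `Ūᵏ = Ū₀ᵏ`, if Theorem 4 holds in the form `Thm4At L k η c₁ G a M ρ Reg Restr Concl` and
`α + 11d²α ≤ c₁`, then from (1.33) = `U₀ ∈ 𝔄_k({□_j}, α) ∧ Reg U₀` and the `𝔄_k`-clause `U ∈ 𝔄_k({□_j}, α)` of (1.34) ALONE — the axial
clause and (1.66) being theorems at the pair — there is exactly one `G`-valued `u` with `Restr U₀ u` ((1.29)) and
`Concl α (11d²α) U₀ U′ u` ((1.37), (1.38), (1.62) for `U₁ = U′^{u⁻¹}`, `U′ = U^{u₀}U₀⁻¹`).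
[cite: Balaban1985RegularSpaces, Thm 4 p.88, (1.33)–(1.34) p.82, (1.66) p.87] -/
theorem concl_of_thm4At_pair (L : ℕ) (hL : 2 ≤ L) (hd : 1 ≤ d) {G : Subgroup 𝔸ˣ} (hG : AvgClosed d L G) (k : ℕ)
    {η c₁ : ℝ} {a : Site d} {M ρ : ℕ}
    {Reg : (Site d → Fin d → 𝔸ˣ) → Prop} {Restr : (Site d → Fin d → 𝔸ˣ) → (Site d → 𝔸ˣ) → Prop}
    {Concl : ℝ → ℝ → (Site d → Fin d → 𝔸ˣ) → (Site d → Fin d → 𝔸ˣ) → (Site d → 𝔸ˣ) → Prop}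
    (hThm4 : Thm4At L k η c₁ G a M ρ Reg Restr Concl)
    (U₀ U : Site d → Fin d → 𝔸ˣ) (hU₀ : ∀ x κ, U₀ x κ ∈ G) (hU : ∀ x κ, U x κ ∈ G) {α : ℝ} (hα : 0 < α)
    (hα3 : C0 d * α ≤ 1 / 3) (hα2 : 2 * α ≤ c2' d L)
    (h33 : pdev U₀ < α * (((L : ℝ) ^ k)⁻¹) ^ 2) (h34 : pdev U < α * (((L : ℝ) ^ k)⁻¹) ^ 2)
    (hpair : avgIter L U k = avgIter L U₀ k) (hsmall : 11 * (d : ℝ) ^ 2 * α ≤ 1 / 6) (hc₁ : α + 11 * (d : ℝ) ^ 2 * α ≤ c₁)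
    (hA₀ : InAk L k η α (cube L a M ρ k) U₀) (hReg : Reg U₀) (hA : InAk L k η α (cube L a M ρ k) U) :
    ∃ u : Site d → 𝔸ˣ, ((∀ x, u x ∈ G) ∧ Restr U₀ u ∧ Concl α (11 * (d : ℝ) ^ 2 * α) U₀ (pert (gaugeAct (ptw L U₀ U k) U) U₀) u) ∧
      ∀ u' : Site d → 𝔸ˣ, (∀ x, u' x ∈ G) → Restr U₀ u' → Concl α (11 * (d : ℝ) ^ 2 * α) U₀ (pert (gaugeAct (ptw L U₀ U k) U) U₀) u' → u' = u := by
  obtain ⟨huG, hUuG, -, -, -, -⟩ := pinnedTwistedFix_global L hL hG k U₀ U hU₀ hU hα hα3 hα2 h33 h34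
  have huU : ∀ x, ptw L U₀ U k x ∈ U1 𝔸 := fun x => hG.le_U1 (huG x)
  have hα₁ : 0 < 11 * (d : ℝ) ^ 2 * α := by
    have : (1 : ℝ) ≤ d := by exact_mod_cast hd
    positivity
  exact hThm4 hα hα₁ hc₁ U₀ (pert (gaugeAct (ptw L U₀ U k) U) U₀) hU₀ (pertPair_mem hU₀ hUuG) hA₀ hReg
    ((inAk_pertPair_iff L k η α _ huU).2 hA)
    (inAx_pertPair L hL hG k U₀ U hU₀ hU hα hα3 hα2 h33 h34 _)
    (cond166_pertPair L hL hd hG k U₀ U hU₀ hU hα hα3 hα2 h33 h34 hpair hsmall a M ρ)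

end Literature.MathematicalPhysics.QuantumFieldTheory.Balaban1983to89.B8Thm4HypothesesPair

end
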